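import Literature.NumberTheory.EllipticCurves.IwasawaSelmer
import Literature.NumberTheory.EllipticCurves.SelmerProofs
import Literature.NumberTheory.EllipticCurves.HeegnerPoints
import Literature.NumberTheory.EllipticCurves.ComplexMultiplicationJInvariantProofs
import Literature.NumberTheory.EllipticCurves.PAdicLFunction
import Literature.NumberTheory.EllipticCurves.VariableChangePointsMap
import HarnessLib

/-!
# The Heegner module and its index in the anticyclotomic tower (Perrin-Riou 1987, Howard 2004)

Definition request `defn-HeegnerModuleIndex` (topic `NumberTheory/EllipticCurves`). Let `E/ℚ` be an
elliptic curve of conductor `N` (model `W`), `K` an imaginary quadratic field satisfying the Heegner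
hypothesis for `N`, `p` a prime and `K_∞/K` the anticyclotomic `ℤ_p`-extension (tree:
`ZpExtension K p`, `ZpExtension.IsAnticyclotomic`) with layers `K_n = κ.layer n`, cut out by
`κ.layerSubgroup n = Gal(K̄/K_n) ≤ Γ_K`, and `Λ = ℤ_p⟦T⟧` (`IwasawaAlgebra p`, `T ↦ γ - 1` for a
topological generator `γ`). This file types the objects of Perrin-Riou's "module de Heegner" and of
Howard's `Λ`-adic Heegner point Kolyvagin system, and vendors the theorems about them as named facts:

1. **Heegner points of conductor `c`** (Gross 1991 §3; Perrin-Riou 1987 §3.1; Howard 2004 §2.7: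
   `h_c = [ℂ/𝒪_c → ℂ/(𝒪_c ∩ 𝔫)⁻¹] ∈ X₀(N)(K[c])`, `P[c] ∈ E(K[c])`), *inside* `E(K̄)`
   (`geomPoints (W.baseChange K)`, where the Galois action and the cohomology of the tree live): a
   ring homomorphism `jbar : K̄ → ℂ` transports a geometric point to `E(ℂ)` (`complexPoint`, through
   the tree's `Affine.Point.congrEquiv`), and
   `IsHeegnerGeomPoint N W K Dt β c jbar x` says that `x` is the image under the modular
   parametrisation `Dt.φ` of the CM point `τ_Q` of a Heegner form `Q = (A, B, C)` of level `N`,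
   discriminant `d_K c²` and `B ≡ c β (mod 2N)` (the ideal `𝔫 ∩ 𝒪_c`) — the conductor-`c` analogue
   of the tree's `IsHeegnerPoint N W K P` (which is the TRACE to `K` at `c = 1`). The ring class
   field `K[c] = K(j(𝒪_c))` (Cox, Thm. 11.1) enters through its Galois group
   `ringClassSubgroup K c jbar = Gal(K̄/K[c]) ≤ Γ_K` (the fixer of the singular moduli of
   discriminant `d_K c²`), and `IsHeegnerNormPoint … n c z` says that `z ∈ E(K̄)` is the norm
   `∑_{σ ∈ Gal(K[c]/K_n)} σ x` of such a point to the layer `K_n` (Howard 2004, §3.3: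
   `Norm_{K[p^{k+1}]/K_k} P[p^{k+1}]`; Perrin-Riou 1987, §3.3–3.4: `tr_{H_{p^n}/D_n} e_{p^n}`).
2. **Compact Selmer groups** (Perrin-Riou 1987, §0, p. 401: `S_p(L) := lim←_k S(L)^{(p^k)}`, the
   limit along multiplication by `p`): for `L = K̄^H`, `H ≤ Γ_K` normal, the `p^k`-Selmer groups
   `selmerTorsionOver W (p^k) H ⊆ H¹(H, E[p^k])` (the torsion-coefficient twin of the tree's
   `selmerGroupOver`), the reduction maps `reduceTorsionH1` induced by `p • : E[p^{k+1}] → E[p^k]`,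
   and `compactSelmerOver W p H ⊆ ∏_k H¹(H, E[p^k])`; together with the Kummer class
   `kummerClassOver` of an `H`-fixed geometric point, the conjugation (`conjPi`), restriction
   (`resPi`) and `ℤ_p`-multiplication (`padicPi`) operators on `∏_k H¹(H, E[p^k])`.
3. **The `Λ`-adic Selmer module `𝔖_p(K_∞) = lim←_n S_p(E/K_n)`** (Perrin-Riou 1987, §0, p. 402:
   limit along corestriction; Howard 2004, §3.2: `≅ H¹(K, T_p E ⊗ Λ)` by Shapiro's lemma, with the
   Selmer structure `F_Λ` up to pseudo-isomorphism) as a **hypothesis structure**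
   `LambdaAdicSelmerData W κ γ`, exactly in the manner of the tree's `SelmerDualData` for the
   discrete Selmer group: an abstract `Λ`-module `S` with projections `proj n : S → S_p(E/K_n)`
   pinned down by identities (`T ↦ conj_γ - 1`, constants through `ℤ_p → ℤ/p^k`, continuity, the
   norm compatibility `res ∘ pr_n = N_{K_{n+1}/K_n} ∘ pr_{n+1}`, and the universal property).
4. **The Heegner module and its index.** For a `HeegnerFamily` (`Dt`, `β` and the norm points
   `y_K ∈ E(K)`, `z_j ∈ E(K_j)` of conductors `1`, `p^{j+1}`), `heegnerModule D F ⊆ D.S` is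
   Perrin-Riou's `ℋ_∞ = lim← ℋ_n` (§3.4) = Howard's `𝐇 = lim← H_k` (§3.3, Thm. 3.3.7: `H_k` the
   `ℤ_p[Gal(K_k/K)]`-span of `y_K, z_0, …, z_k` in `E(K_k) ⊗ ℤ_p ↪ S_p(E/K_k)`);
   `heegnerCharIdeal D F = char_Λ(S/ℋ_∞)` is Perrin-Riou's `I(ℋ_∞)` (§1, p. 405) = Howard's `𝐋`
   (§1, (2)); and **`heegnerModuleIndex D F = ord_J I(ℋ_∞) ∈ ℕ∞`**, the multiplicity of the
   augmentation prime `J = (γ - 1) = (T)` in it (the local length of `S/ℋ_∞` at `(T)`), is the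
   index `a(E, K, p)` of the request: for `S` torsion-free of rank one and `ℋ_∞ = Λ κ_∞` free
   (the theorems below) it is `max {a : κ_∞ ∈ (γ - 1)^a S ⊗ ℚ_p}`.
5. **Named facts** (`def … : Prop`, cited; D-0014): existence of `K[c]`-rational Heegner points of
   every conductor prime to `N` and of their norms (`exists_isHeegnerNormPoint`, Howard §2.7/§3.3,
   Gross §3, Darmon Thm. 3.6; assembled into `Nonempty (HeegnerFamily …)` by the theorem
   `nonempty_heegnerFamily_of`); existence and uniqueness of the `Λ`-adic Selmer
   datum (`lambdaAdicSelmerData_exists_unique`); Howard 2004, Thm. B — (a) `S` is torsion-free of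
   rank one (with Perrin-Riou §2.2 Lemme 5), (b)(c) in characteristic-ideal form, `rank_Λ X = 1` and
   `char(X_{Λ-tors}) ∣ I(ℋ_∞)²` (`Howard2004_thmB`); Howard 2004, Thm. 3.3.7 (Perrin-Riou §3.4
   Prop. 10 + Cornut 2002): `ℋ_∞` is free of rank one (`Howard2004_heegnerModule_free`); and Howard
   2004, §1 (2): `corank_{ℤ_p} Sel_{p^∞}(E/K) ≤ 1 + 2 · ord_J I(ℋ_∞)` (`Howard2004_selmerCorank_le`),
   with the proved corollary `rank E(K) ≤ 1 + 2 · a(E, K, p)`.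

## Design notes

* Why a hypothesis structure for `𝔖_p(K_∞)`. The honest construction needs either corestriction in
  continuous cohomology (the transition maps of `lim←_n`) or `H¹(K, T_p E ⊗ Λ)` with Greenberg local
  conditions; neither is in Mathlib or the tree (which, for the same reason, packages the Iwasawa
  module `X(E/K_∞)` as `SelmerDualData`). Everything FINITE-level is constructed: `S_p(E/K_n)` is a
  genuine subgroup of `∏_k H¹(Gal(K̄/K_n), E[p^k])` and the pinning identities are equations there.
  The norm compatibility is recorded as `res_{K_n}^{K_{n+1}}(x_n) = ∑_{i<p} conj_{γ^{p^n i}}(x_{n+1})`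
  (`res ∘ cor = N_{K_{n+1}/K_n}`, `Gal(K_{n+1}/K_n) = ⟨γ^{p^n}⟩`), which characterises
  `x_n = cor(x_{n+1})` as soon as restriction is injective, i.e. `E(K_{n+1})[p] = 0` — automatic under
  the standing hypothesis `Γ_K ↠ Aut_{ℤ_p}(T_p E)` of every fact below (Howard 2004, §2.7: "our
  assumption … guarantees that `E(K[n])[p] = 0`"); in general `D.S` contains `𝔖_p(K_∞)`.
* Orientation and parametrisation are FIXED across the family (`HeegnerFamily.Dt`, `.β`): two
  parametrisations differ by an integer factor and two orientations by an Atkin–Lehner sign and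
  torsion, which would change the module generated by a *mixed* family; with them fixed, the
  predicate `IsHeegnerNormPoint` determines each `z_j` up to `Gal(K_j/K)`-translates (the
  `Pic(𝒪_c)`-orbit of `h_c` is its Galois orbit), hence determines `ℋ_n`, `ℋ_∞` and the index.
* `p ∤ h_K` (Howard §3.3) makes `K_n ⊂ K[p^{n+1}]` (the maximal `p`-subextension), so that the
  transversal sums of `IsHeegnerNormPoint` are the genuine norms `Norm_{K[p^{n+1}]/K_n}` of Howard;
  without it they are the norms from the composita `K_n K[p^{n+1}]` (Perrin-Riou's general setting,
  §3.2, `D_n = H_{cp^n} ∩ D_∞`); the facts carry `p ∤ h_K`.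
* Hypotheses of the facts are Howard's (Compositio 140 (2004), Thm. A/B and §3): `p ∤ 2 N d_K`,
  `d_K ∉ {-3, -4}`, Heegner hypothesis, `Γ_K → Aut_{ℤ_p}(T_p E)` surjective, `E` good ordinary at `p`
  (`IsOrdinaryAt`, whence `[W.IsGloballyMinimal]`), `p ∤ h_K`; `N = N_E` and modularity ride in the
  datum `Dt` (as in `kolyvagin`). The variant under "`p ≥ 5`, `E[p]` irreducible, `p ∤` Tamagawa"
  quoted in the request is a different (later) theorem and is NOT vendored here.
* Mathlib/tree search: `Heegner.*conductor`, `ringClassField`, `compact.*Selmer`, `corestriction`,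
  `HeegnerModule` — nothing; reused: `subgroupH1`, `resH1Hom`, `conjH1`, `resOfLe`,
  `localSubgroupOfEmb`, `pointsMapOfEmb`, `closureEmb`, `cobCocycle`, `contOneCocycles.lift`,
  `oneCocycleClass`, `heegnerForms`, `heegnerTau`, `ModularParametrizationData.φ`, `formJ`,
  `reducedForms`, `ZpExtension.layerSubgroup`, `SelmerDualData`, `Module.charIdeal`,
  `Module.lengthAt`, `selmerCorank`, `galoisRepTate`, `IsOrdinaryAt`.

## References

* [Howard2004HeegnerKolyvagin] B. Howard, *The Heegner point Kolyvagin system*, Compositio Math.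
  140 (2004), 1439–1472 (held: `paper:arxiv-1202.6340`, the author's TeX): §1 Thm. A, Thm. B and
  eq. (2); §2.7 (Heegner points `h_m`, `P[m]`); §3 (standing hypotheses), Def. 3.2.3, Def. 3.2.6,
  Lemma 3.2.9, Thm. 3.2.10, §3.3 (`P_k[n]`, `H_k[n]`), Thm. 3.3.1, Thm. 3.3.7. NUMBERING CAVEAT: all
  section/item numbers of this source are those of the held TeX/arXiv version (Introduction = §1,
  "Kolyvagin systems" = §2 with "Heegner points" = §2.7, "Iwasawa theory" = §3 with "The
  anticyclotomic Euler system" = §3.3, whose closing theorem "`𝐇` is free of rank one" is 3.3.7);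
  the journal numbers the same items one section lower (TeX §2 = journal §1, TeX §3 = journal §2:
  Lemma 3.2.9 / Thm. 3.2.10 / §3.3 / Thm. 3.3.1 / Thm. 3.3.7 = journal 2.2.9 / 2.2.10 / §2.3 / 2.3.1 /
  2.3.7, and §2.7 = journal §1.7), as cited by Castella–Grossi–Lee–Skinner, Invent. Math. 227 (2022)
  ("[How04a, Thm. 2.2.10]", "[Thm. 2.3.1]", "[§2.3]") and Keller–Yin 2024a ("[How2004, Theorem 2.2.10]");
  concordance checked in the cell `bsd-cited` audit D-AUDIT-r19-S3 (sheet 881e4eccf50bfe40). Theorems A,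
  B and eq. (2) of the Introduction are stable.
* [PerrinRiou1987BSMF] B. Perrin-Riou, *Fonctions `L` `p`-adiques, théorie d'Iwasawa et points de
  Heegner*, Bull. SMF 115 (1987), 399–456 (held: `paper:doi-10-24033-bsmf-2085`): §0 pp. 401–402
  (`S_p(L)`, `𝔖_p(L)`), §1 p. 405 (`H_∞ ⊂ 𝔖_p(D_∞)`, Prop. 2, `I(H_∞)`, Conj. B), §3.1 (Heegner
  points of level `c`), §3.2 (`D_n`), §3.3 (Lemme 1, Prop. 3, Cor. 5), §3.4 (`ℋ_n`, `ℋ_∞`, Prop. 10).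
* [Cornut2002] C. Cornut, *Mazur's conjecture on higher Heegner points*, Invent. Math. 148 (2002)
  (not held; enters only through Howard's proof of Thm. 3.3.7).
* [Bertolini1995] M. Bertolini, Compositio Math. 99 (1995), 153–182 (parts (a), (b) of Thm. B;
  cited by Howard).
* [GrossLMS1991] B. H. Gross, *Kolyvagin's work on modular elliptic curves* (1991), §3.
* [Cox2013] D. A. Cox, *Primes of the form x² + ny²*, Thm. 11.1 (`K(j(𝒪))` is the ring class field).
-/

noncomputable section

open scoped Classical

open NumberField IsDedekindDomain

universe u

/-! ## Part 1. Compact Selmer groups `S_p(E/L)` over `L = K̄^H` (Perrin-Riou 1987, §0) -/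

namespace WeierstrassCurve

open Literature.NumberTheory.EllipticCurves Literature.NumberTheory.GaloisRepresentations

variable {K : Type u} [Field K] (W : WeierstrassCurve K)

/-- `H¹(H, E[m]) = H¹_cont(H, E(K̄)[m])` for a subgroup `H ≤ Γ_K` (the tree's `subgroupH1` with the
discrete coefficients `geomTorsion W m`); for `H = Gal(K̄/L)` this is `H¹(L, E[m])`.
Perrin-Riou 1987, §0; Serre, *Galois Cohomology*, II.§1. [folklore] -/
abbrev torsionH1Over (m : ℤ) (H : Subgroup (Field.absoluteGaloisGroup K)) : Type u :=
  Literature.NumberTheory.EllipticCurves.subgroupH1 H (geomTorsion W m)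

/-- Multiplication by `p`: `E[p^{k+1}] → E[p^k]`, `P ↦ p • P` (a `Γ_K`-equivariant homomorphism).
Perrin-Riou 1987, §0 ("les homomorphismes de transition étant induits par la multiplication par
`p`"). [cite: PerrinRiou1987BSMF, §0 p. 401] -/
def geomTorsionReduce (p k : ℕ) :
    geomTorsion W ((p : ℤ) ^ (k + 1)) →+ geomTorsion W ((p : ℤ) ^ k) :=
  ((zsmulAddGroupHom (α := geomPoints W) (p : ℤ)).comp
    (geomTorsion W ((p : ℤ) ^ (k + 1))).subtype).codRestrict (geomTorsion W ((p : ℤ) ^ k))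
    fun P ↦ by
      rw [mem_geomTorsion_iff, AddMonoidHom.coe_comp, Function.comp_apply,
        AddSubgroup.coe_subtype, zsmulAddGroupHom_apply, smul_smul, ← pow_succ,
        ← mem_geomTorsion_iff]
      exact P.2

/-- Values of `geomTorsionReduce`. [folklore] -/
@[simp]
theorem coe_geomTorsionReduce (p k : ℕ) (P : geomTorsion W ((p : ℤ) ^ (k + 1))) :
    ((W.geomTorsionReduce p k P : geomTorsion W ((p : ℤ) ^ k)) : geomPoints W) = (p : ℤ) • (P : geomPoints W) :=
  rfl

/-- The transition map `H¹(H, E[p^{k+1}]) → H¹(H, E[p^k])` induced by `p • : E[p^{k+1}] → E[p^k]`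
(functoriality of continuous cohomology along the compatible pair `(id_H, p •)`).
Perrin-Riou 1987, §0 (the transition maps of `S_p(L) = lim← S(L)^{(p^k)}`).
[cite: PerrinRiou1987BSMF, §0 p. 401] -/
def reduceTorsionH1 (p k : ℕ) (H : Subgroup (Field.absoluteGaloisGroup K)) :
    W.torsionH1Over ((p : ℤ) ^ (k + 1)) H →+ W.torsionH1Over ((p : ℤ) ^ k) H :=
  resH1Hom (ContinuousMonoidHom.id H) (W.geomTorsionReduce p k) fun x P ↦ Subtype.ext (by
    change (p : ℤ) • ((x : Field.absoluteGaloisGroup K) • (P : geomPoints W)) =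
      (x : Field.absoluteGaloisGroup K) • ((p : ℤ) • (P : geomPoints W))
    rw [smul_zsmul_geomPoints])

section Local

variable {E : Type u} [Field E] [Algebra K E]

/-- The local restriction `H¹(H, E[m]) → H¹(H_E, E(K̄_E))` attached to a `K`-embedding
`ι : K̄ → K̄_E` (compatible pair `(H_E → H, E[m] ↪ E(K̄) → E(K̄_E))`; the torsion-coefficient twin
of the tree's `localResOverOfEmb`). Its kernel is the local Selmer condition at the place of
`L = K̄^H` singled out by `ι`. Greenberg (1999), §2; Milne, *ADT*, I.§6. [cite: GreenbergLNM1716, §2] -/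
def localResTorsionOverOfEmb (m : ℤ) (H : Subgroup (Field.absoluteGaloisGroup K))
    (ι : AlgebraicClosure K →ₐ[K] AlgebraicClosure E) :
    W.torsionH1Over m H →+ discreteH1 (localSubgroupOfEmb H ι) (localPoints W E) :=
  resH1Hom (resGalSubgroupOfEmb H ι) ((pointsMapOfEmb W ι).comp (geomTorsion W m).subtype)
    fun τ P ↦ by
    simp only [AddMonoidHom.coe_comp, AddSubgroup.coe_subtype, Function.comp_apply,
      Subgroup.smul_def, resGalSubgroupOfEmb_apply_coe,
      Literature.NumberTheory.EllipticCurves.AddSubgroup.torsionBy.coe_smul]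
    exact pointsMapOfEmb_smul W ι τ P

end Local

section NumberField

variable [NumberField K] (H : Subgroup (Field.absoluteGaloisGroup K)) [H.Normal]

/-- The **`m`-Selmer group over `L = K̄^H`**, `S(L)^{(m)} = Sel^{(m)}(E/L) ⊆ H¹(H, E[m])`, for a normal
subgroup `H ≤ Γ_K`: the classes `c` such that `conj_σ c` dies in `H¹(H_{K_v}, E(K̄_v))` for every
place `v` of `K` (finite `v.adicCompletion K`, infinite `w.Completion`) and every `σ ∈ Γ_K` — the
local condition at every place of `L` above `v` (these are the `Γ_K`-conjugates of the chosen one),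
exactly as the tree's `selmerGroupOver` does for `E[p^∞]`. Perrin-Riou 1987, §0 (p. 401: "le groupe
de Selmer de `E/L` relatif à `p^n` est défini comme le noyau de
`H¹(L, E_{p^n}) → ∏_v H¹(L_v, E)`"); Milne, *ADT*, I.§6. [cite: PerrinRiou1987BSMF, §0 p. 401] -/
def selmerTorsionOver (m : ℤ) : AddSubgroup (W.torsionH1Over m H) :=
  (⨅ (v : HeightOneSpectrum (𝓞 K)) (σ : Field.absoluteGaloisGroup K),
      (W.localResTorsionOverOfEmb m H (closureEmb (K := K) (v.adicCompletion K))).ker.comap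
        (Literature.NumberTheory.EllipticCurves.conjH1 H (geomTorsion W m) σ)) ⊓
    ⨅ (w : InfinitePlace K) (σ : Field.absoluteGaloisGroup K),
      (W.localResTorsionOverOfEmb m H (closureEmb (K := K) w.Completion)).ker.comap
        (Literature.NumberTheory.EllipticCurves.conjH1 H (geomTorsion W m) σ)

/-- The **compact Selmer group** `S_p(E/L) = lim←_k Sel^{(p^k)}(E/L)` of `L = K̄^H` (Perrin-Riou 1987,
§0, p. 401: "notons `S_p(L)` la limite projective des groupes de Selmer `S(L)^{(p^n)}`, les
homomorphismes de transition étant induits par la multiplication par `p`"; Howard 2004, §1), as the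
subgroup of `∏_k H¹(H, E[p^k])` of the families `(x_k)` with `x_k ∈ Sel^{(p^k)}(E/L)` and
`p_* x_{k+1} = x_k` (`reduceTorsionH1`). It receives `E(L) ⊗ ℤ_p` by the Kummer maps and surjects onto
the Tate module of `Ш(E/L)[p^∞]`. [cite: PerrinRiou1987BSMF, §0 p. 401] -/
def compactSelmerOver (p : ℕ) : AddSubgroup (Π k : ℕ, W.torsionH1Over ((p : ℤ) ^ k) H) :=
  (AddSubgroup.pi Set.univ fun k ↦ W.selmerTorsionOver H ((p : ℤ) ^ k)) ⊓
    ⨅ k : ℕ, AddMonoidHom.ker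
      (((W.reduceTorsionH1 p k H).comp
          (Pi.evalAddMonoidHom (fun j : ℕ ↦ W.torsionH1Over ((p : ℤ) ^ j) H) (k + 1))) -
        Pi.evalAddMonoidHom (fun j : ℕ ↦ W.torsionH1Over ((p : ℤ) ^ j) H) k)

/-- Membership in `S_p(E/L)`: Selmer at every level and compatible under `p_*`.
[cite: PerrinRiou1987BSMF, §0 p. 401] -/
theorem mem_compactSelmerOver_iff (p : ℕ) (x : Π k : ℕ, W.torsionH1Over ((p : ℤ) ^ k) H) :
    x ∈ W.compactSelmerOver H p ↔
      (∀ k, x k ∈ W.selmerTorsionOver H ((p : ℤ) ^ k)) ∧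
        ∀ k, W.reduceTorsionH1 p k H (x (k + 1)) = x k := by
  simp only [compactSelmerOver, AddSubgroup.mem_inf, AddSubgroup.mem_pi, Set.mem_univ, true_implies,
    AddSubgroup.mem_iInf, AddMonoidHom.mem_ker, AddMonoidHom.sub_apply, AddMonoidHom.coe_comp,
    Function.comp_apply, Pi.evalAddMonoidHom_apply, sub_eq_zero]

end NumberField

/-! ### Componentwise operators on `∏_k H¹(H, E[p^k])` -/

/-- Conjugation by `σ ∈ Γ_K` on `∏_k H¹(H, E[p^k])`, componentwise the tree's `conjH1` (the action of
`Gal(L/K)` on `H¹(L, ·)`; for `L = K_n` and `σ = γ` this is the action through which `T = γ - 1`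
acts). Perrin-Riou 1987, §0; Greenberg (1999), §1. [cite: PerrinRiou1987BSMF, §0 pp. 400–402] -/
def conjPi (p : ℕ) (H : Subgroup (Field.absoluteGaloisGroup K)) [H.Normal]
    (σ : Field.absoluteGaloisGroup K) :
    (Π k : ℕ, W.torsionH1Over ((p : ℤ) ^ k) H) →+ Π k : ℕ, W.torsionH1Over ((p : ℤ) ^ k) H :=
  AddMonoidHom.pi fun k ↦
    (Literature.NumberTheory.EllipticCurves.conjH1 H (geomTorsion W ((p : ℤ) ^ k)) σ).comp
      (Pi.evalAddMonoidHom (fun j : ℕ ↦ W.torsionH1Over ((p : ℤ) ^ j) H) k)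

/-- Restriction `∏_k H¹(H', E[p^k]) → ∏_k H¹(H, E[p^k])` for `H ≤ H'`, componentwise the tree's
`resOfLe` (for `H = Gal(K̄/K_{n+1}) ≤ H' = Gal(K̄/K_n)`: `res : S_p(E/K_n) → S_p(E/K_{n+1})`).
Perrin-Riou 1987, §0. [cite: PerrinRiou1987BSMF, §0 pp. 401–402] -/
def resPi (p : ℕ) {H H' : Subgroup (Field.absoluteGaloisGroup K)} (h : H ≤ H') :
    (Π k : ℕ, W.torsionH1Over ((p : ℤ) ^ k) H') →+ Π k : ℕ, W.torsionH1Over ((p : ℤ) ^ k) H :=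
  AddMonoidHom.pi fun k ↦
    (Literature.NumberTheory.EllipticCurves.resOfLe (geomTorsion W ((p : ℤ) ^ k)) h).comp
      (Pi.evalAddMonoidHom (fun j : ℕ ↦ W.torsionH1Over ((p : ℤ) ^ j) H') k)

/-- The action of a `p`-adic integer `c` on `∏_k H¹(H, E[p^k])`: on the `k`-th component, which is
killed by `p^k`, `c` acts through `ℤ_p → ℤ/p^k` (`PadicInt.toZModPow k c`, any lift to `ℤ`). This is
the `ℤ_p`-module structure of `S_p(E/L)` (Perrin-Riou 1987, §0: "des `ℤ_p`-modules compacts").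
[cite: PerrinRiou1987BSMF, §0 p. 401] -/
def padicPi (p : ℕ) [Fact p.Prime] (H : Subgroup (Field.absoluteGaloisGroup K)) (c : ℤ_[p]) :
    (Π k : ℕ, W.torsionH1Over ((p : ℤ) ^ k) H) →+ Π k : ℕ, W.torsionH1Over ((p : ℤ) ^ k) H :=
  AddMonoidHom.pi fun k ↦
    (zsmulAddGroupHom ((PadicInt.toZModPow k c).val : ℤ)).comp
      (Pi.evalAddMonoidHom (fun j : ℕ ↦ W.torsionH1Over ((p : ℤ) ^ j) H) k)

/-! ### Kummer classes over `H` -/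

section Kummer

variable (H : Subgroup (Field.absoluteGaloisGroup K)) (m : ℤ)

variable {W H m} in
/-- For `Q ∈ E(K̄)` with `m • Q` fixed by `H`, the point `σ • Q - Q` (`σ ∈ H`) is `m`-torsion.
Silverman, *AEC*, VIII.§2. [folklore] -/
theorem smul_sub_mem_geomTorsion_of_subgroup {Q : geomPoints W}
    (hQ : ∀ σ ∈ H, σ • (m • Q) = m • Q) (σ : H) : σ • Q - Q ∈ geomTorsion W m := by
  rw [mem_geomTorsion_iff, zsmul_sub, sub_eq_zero]
  change m • ((σ : Field.absoluteGaloisGroup K) • Q) = m • Q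
  rw [← smul_zsmul_geomPoints, hQ σ σ.2]

/-- The **Kummer cocycle over `L = K̄^H`**: `σ ↦ σ • Q - Q ∈ E[m]` on `H`, for `Q ∈ E(K̄)` with
`m • Q ∈ E(L) = E(K̄)^H` (the coboundary of `Q` in the discrete `H`-module `E(K̄)`, values restricted
to `E[m]`; the tree's `kummerCocycleTorsion` is the case `H = Γ_K`).
Silverman, *AEC*, VIII.§2 (`c_σ = Q^σ - Q`). [folklore] -/
def kummerCocycleOver (Q : geomPoints W) (hQ : ∀ σ ∈ H, σ • (m • Q) = m • Q) :
    contOneCocycles (discreteTopRep H (geomTorsion W m)) :=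
  contOneCocycles.lift (geomTorsion W m).subtype (fun _ _ => rfl) Subtype.val_injective
    (cobCocycle (G := H) Q ((continuous_smul_geomPoints W Q).comp continuous_subtype_val))
    (fun σ => ⟨σ • Q - Q, smul_sub_mem_geomTorsion_of_subgroup hQ σ⟩) (fun _ => rfl)

/-- Values of the Kummer cocycle over `H`. [folklore] -/
@[simp]
theorem coe_kummerCocycleOver_apply (Q : geomPoints W) (hQ : ∀ σ ∈ H, σ • (m • Q) = m • Q)
    (σ : H) : ((W.kummerCocycleOver H m Q hQ).1 σ : geomPoints W) = σ • Q - Q :=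
  rfl

/-- The **Kummer class** `δ_L(m • Q) = [σ ↦ σ • Q - Q] ∈ H¹(H, E[m]) = H¹(L, E[m])` of the
`L`-rational point `m • Q`, `L = K̄^H` (Silverman, *AEC*, VIII.§2; Perrin-Riou 1987, §0 and §3.4,
where `E(D_n) ⊗ ℤ_p ↪ S_p(D_n)` through these classes; Howard 2004, §3.3, "the Kummer map
`δ_k(n) : E(K_k[n]) ⊗ ℤ_p → H¹(K_k[n], T_p(E))`"). [cite: Howard2004HeegnerKolyvagin, §3.3] -/
def kummerClassOver (Q : geomPoints W) (hQ : ∀ σ ∈ H, σ • (m • Q) = m • Q) :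
    W.torsionH1Over m H :=
  oneCocycleClass _ (W.kummerCocycleOver H m Q hQ)

end Kummer

/-! ## Part 2. The `Λ`-adic Selmer module `𝔖_p(K_∞) = lim←_n S_p(E/K_n)` as a hypothesis structure -/

section LambdaAdic

variable [NumberField K] {p : ℕ} [Fact p.Prime] (κ : ZpExtension K p)
  (γ : Field.absoluteGaloisGroup K)

/-- **`Λ`-adic Selmer data for `E` over the `ℤ_p`-extension `κ`** (hypothesis structure, cf.
`SelmerDualData`). A term packages Perrin-Riou's compact `Λ`-module
`𝔖_p(K_∞) = lim←_n S_p(E/K_n)` (Bull. SMF 115, §0, p. 402: the limit over the layers along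
corestriction; Howard 2004, Def. 3.2.3 and §1: `≅ H¹(K, 𝐓)`, `𝐓 = lim← Ind_{K_n/K} T_p E ≅ T_p E ⊗ Λ`,
with `H¹_{F_Λ}(K, 𝐓) ∼ lim← S_p(E/K_n)`) as an abstract `Λ = ℤ_p⟦T⟧`-module `S` together with group
homomorphisms `proj n : S → ∏_k H¹(Gal(K̄/K_n), E[p^k])` and the identities pinning everything down:
* `proj_mem`: `proj n` lands in the compact Selmer group `S_p(E/K_n)` (`compactSelmerOver`);
* `proj_X`: `T` acts as `γ - 1` (`conjPi … γ`), `proj_C`: constants `c ∈ ℤ_p` act through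
  `ℤ_p → ℤ/p^k` on the `k`-th component (`padicPi`), `proj_cont`: a power series with no terms of
  degree `< k p^n` acts as `0` on the `(n, k)` component (`T^{p^n} ∈ (p, ω_n)`, `ω_n = (1+T)^{p^n} - 1`
  killing `H¹(K_n, ·)`) — so `f ∈ Λ` acts through `ℤ_p[Gal(K_n/K)]` at level `n`, continuously;
* `proj_norm`: the components are norm-compatible, written as
  `res_{K_n}^{K_{n+1}}(x_n) = ∑_{i<p} conj_{γ^{p^n i}}(x_{n+1})` (`res ∘ cor = N_{K_{n+1}/K_n}` and
  `Gal(K_{n+1}/K_n) = {γ^{p^n i}}_{i<p}`; see the module docstring for when this is `x_n = cor x_{n+1}`);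
* `ext`, `surj`: `s ↦ (proj n s)_n` is a bijection onto the norm-compatible families.
For `γ` a topological generator such data exist and are unique up to `Λ`-isomorphism
(`lambdaAdicSelmerData_exists_unique`).
[cite: PerrinRiou1987BSMF, §0 p. 402] [cite: Howard2004HeegnerKolyvagin, §1 and Def. 3.2.3] -/
structure LambdaAdicSelmerData (W : WeierstrassCurve K) {p : ℕ} [Fact p.Prime]
    (κ : ZpExtension K p) (γ : Field.absoluteGaloisGroup K) where
  /-- The underlying type of `𝔖_p(K_∞)`. -/
  S : Type u
  /-- `S` is an abelian group. -/
  [addCommGroup : AddCommGroup S]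
  /-- `S` is a `Λ = ℤ_p⟦T⟧`-module. -/
  [module : Module (IwasawaAlgebra p) S]
  /-- The projection to level `n`: `S → ∏_k H¹(Gal(K̄/K_n), E[p^k])`. -/
  proj (n : ℕ) : S →+ Π k : ℕ, W.torsionH1Over ((p : ℤ) ^ k) (κ.layerSubgroup n)
  /-- `proj n` lands in the compact Selmer group `S_p(E/K_n)`. -/
  proj_mem : ∀ n s, proj n s ∈ W.compactSelmerOver (κ.layerSubgroup n) p
  /-- `T` acts as `γ - 1`. -/
  proj_X : ∀ n s, proj n ((PowerSeries.X : IwasawaAlgebra p) • s) =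
    W.conjPi p (κ.layerSubgroup n) γ (proj n s) - proj n s
  /-- Constants `c ∈ ℤ_p` act through `ℤ_p → ℤ/p^k` on the `k`-th components. -/
  proj_C : ∀ n s (c : ℤ_[p]), proj n (PowerSeries.C c • s) = W.padicPi p (κ.layerSubgroup n) c (proj n s)
  /-- Continuity: a power series without terms of degree `< k p^n` kills the `(n, k)` component. -/
  proj_cont : ∀ n k s (f : IwasawaAlgebra p), (∀ i < k * p ^ n, PowerSeries.coeff i f = 0) →
    proj n (f • s) k = 0
  /-- Norm compatibility: `res (x_n) = ∑_{i<p} conj_{γ^{p^n i}} (x_{n+1})`. -/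
  proj_norm : ∀ n s, W.resPi p (κ.layerSubgroup_antitone (Nat.le_succ n)) (proj n s) =
    ∑ i ∈ Finset.range p, W.conjPi p (κ.layerSubgroup (n + 1)) (γ ^ (p ^ n * i)) (proj (n + 1) s)
  /-- Joint injectivity of the projections. -/
  ext : ∀ s, (∀ n, proj n s = 0) → s = 0
  /-- Every norm-compatible family of compact Selmer elements comes from `S`. -/
  surj : ∀ x : (Π n k : ℕ, W.torsionH1Over ((p : ℤ) ^ k) (κ.layerSubgroup n)),
    (∀ n, x n ∈ W.compactSelmerOver (κ.layerSubgroup n) p) →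
    (∀ n, W.resPi p (κ.layerSubgroup_antitone (Nat.le_succ n)) (x n) =
      ∑ i ∈ Finset.range p, W.conjPi p (κ.layerSubgroup (n + 1)) (γ ^ (p ^ n * i)) (x (n + 1))) →
    ∃ s, ∀ n, proj n s = x n

attribute [instance] LambdaAdicSelmerData.addCommGroup LambdaAdicSelmerData.module

namespace LambdaAdicSelmerData

variable {W κ γ} (D : W.LambdaAdicSelmerData κ γ)

/-- The projections are jointly injective: `s` is determined by its components `(proj n s)_n`.
[cite: PerrinRiou1987BSMF, §0 p. 402] -/
theorem proj_injective : Function.Injective fun s n ↦ D.proj n s := by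
  intro s t h
  rw [← sub_eq_zero]
  refine D.ext _ fun n ↦ ?_
  rw [map_sub, sub_eq_zero]
  exact congrFun h n

end LambdaAdicSelmerData

/-- **Existence and uniqueness of `𝔖_p(K_∞)`** as a `Λ`-module with the listed properties. For `γ`
a topological generator of `Gal(K_∞/K)` such data exist: the group of norm-compatible families in
`∏_n S_p(E/K_n)` is a compact `ℤ_p⟦Gal(K_∞/K)⟧`-module, `γ` acting on `H¹(K_n, ·)` by conjugation and
`γ^{p^n} ∈ Gal(K̄/K_n)` trivially (inner automorphisms), so that `ℤ_p⟦T⟧ = lim ℤ_p[Gal(K_n/K)]`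
acts (Perrin-Riou 1987, §0, p. 402: "`𝔖_p(L)` la limite projective des `S_p(F')` … les
homomorphismes de transition sont induits par la corestriction … Ce dernier `ℤ_p`-module sera
essentiel ici"; Howard 2004, Def. 3.2.3). And any two data have `Λ`-isomorphic modules compatibly
with the projections (the bijection `surj' ∘ proj` commutes with `T`, with `ℤ_p` and, by
`proj_cont`, with every power series levelwise). [cite: PerrinRiou1987BSMF, §0 p. 402]
[cite: Howard2004HeegnerKolyvagin, Def. 3.2.3] -/
def lambdaAdicSelmerData_exists_unique : Prop :=
  (∀ (_ : κ.IsTopGenerator γ), Nonempty (W.LambdaAdicSelmerData κ γ)) ∧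
    ∀ (D D' : W.LambdaAdicSelmerData κ γ),
      ∃ e : D.S ≃ₗ[IwasawaAlgebra p] D'.S, ∀ n s, D'.proj n (e s) = D.proj n s

end LambdaAdic

end WeierstrassCurve

/-! ## Part 3. Heegner points of conductor `c` inside `E(K̄)` and their norms to the layers -/

namespace Literature.NumberTheory.EllipticCurves

open WeierstrassCurve ModularForms
open Literature.NumberTheory.QuadraticFields.BinaryQuadraticForm (reducedForms)

section HeegnerGeom

/-- The **complex point** of a geometric point: `E(K̄) → E(ℂ)` along a ring homomorphism
`jbar : K̄ → ℂ` (Mathlib `Affine.Point.map`, after the tree's transport `Affine.Point.congrEquiv`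
along `(W/K)/K̄ = W/K̄`, Mathlib `map_baseChange`). All Heegner-point sources work with
`K ⊂ K[c] ⊂ ℂ`; `jbar` fixes such an embedding of `K̄ ⊃ K[c]` once and for all.
Gross 1991, §3; Howard 2004, §2.7. [folklore] -/
def complexPoint {K : Type u} [Field K] [NumberField K] (W : WeierstrassCurve ℚ)
    (jbar : AlgebraicClosure K →+* ℂ) :
    geomPoints (W.baseChange K) →+ (W.baseChange ℂ).toAffine.Point :=
  (WeierstrassCurve.Affine.Point.map (W' := W) jbar.toRatAlgHom).comp
    (WeierstrassCurve.Affine.Point.congrEquiv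
      (W.map_baseChange (Algebra.ofId K (AlgebraicClosure K)))).toAddMonoidHom

variable (N : ℕ) [NeZero N] (W : WeierstrassCurve ℚ) (K : Type u) [Field K] [NumberField K]

/-- **Heegner point of conductor `c` (as a geometric point).** `x ∈ E(K̄)` is the Heegner point
`P[c] = φ(h_c)` of level `N`, conductor `c` and orientation `β` for the parametrisation datum `Dt`:
its complex point is `Dt.φ(τ_Q)` for a Heegner form `Q = (A, B, C)` of level `N` (`N ∣ A`) and
discriminant `d_K c²` (`heegnerForms N (d_K c²)`: `τ_Q` has CM by the order `𝒪_c` of conductor `c`)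
with `B ≡ c β (mod 2N)` (the cyclic `N`-isogeny `ℂ/𝒪_c → ℂ/(𝒪_c ∩ 𝔫)⁻¹` for the ideal `𝔫 ↔ β`,
`β² ≡ d_K (mod 4N)`; the forms with this residue are one `Pic(𝒪_c) = Gal(K[c]/K)`-orbit, so `x` is
determined up to `Gal(K[c]/K)`-conjugation). Under the Heegner hypothesis and `gcd(c, N) = 1` both
`τ_Q` and `N τ_Q` have exact order `𝒪_c` (a prime `q ∣ gcd(A/N, B)` with `q ∣ N` would divide
`d_K c²`). Sources: Howard 2004, §2.7 ("`h_m = [ℂ/𝒪_m → ℂ/(𝒪_m ∩ 𝔞)⁻¹]` … The point `h_m` is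
rational over the ring class field of conductor `m` … `P[m] ∈ E(K[m])`, the Heegner point of
conductor `m`"); Gross 1991, §3; Perrin-Riou 1987, §3.1 ("point de Heegner de niveau `c`").
[cite: Howard2004HeegnerKolyvagin, §2.7] [cite: GrossLMS1991, §3] [cite: PerrinRiou1987BSMF, §3.1] -/
def IsHeegnerGeomPoint (Dt : ModularParametrizationData W N) (β : ℤ) (c : ℕ)
    (jbar : AlgebraicClosure K →+* ℂ) (x : geomPoints (W.baseChange K)) : Prop :=
  ∃ Q ∈ heegnerForms N (NumberField.discr K * (c : ℤ) ^ 2),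
    Q.2.1 ≡ c * β [ZMOD 2 * N] ∧ complexPoint W jbar x = Dt.φ (heegnerTau Q)

/-- **The ring class subgroup `Gal(K̄/K[c]) ≤ Γ_K`** of conductor `c`, through `jbar : K̄ → ℂ`: the
elements of `Γ_K` fixing every `a ∈ K̄` whose image `jbar a` is a singular modulus `j(τ_Q)` of
discriminant `d_K c²` (`formJ`, `reducedForms` of the tree's CM files), i.e. fixing
`K(j(𝒪_c)) = K[c]`, the ring class field of conductor `c` (Cox, Thm. 11.1: "`K(j(𝔞))` is the ring
class field of the order `𝒪`"; Perrin-Riou 1987, §3.1: "Ringklassenkörper de `k` de conducteur `c` …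
groupe de Galois … isomorphe à `Pic(𝒪_c)`"). Nothing about it is asserted here.
[cite: Cox2013, Thm. 11.1] [cite: PerrinRiou1987BSMF, §3.1] -/
def ringClassSubgroup (c : ℕ) (jbar : AlgebraicClosure K →+* ℂ) :
    Subgroup (Field.absoluteGaloisGroup K) :=
  (⨅ a ∈ {a : AlgebraicClosure K |
      jbar a ∈ (reducedForms (NumberField.discr K * (c : ℤ) ^ 2)).image formJ},
    MulAction.stabilizer (AlgebraicClosure K ≃ₐ[K] AlgebraicClosure K) a).comap
    (Field.absoluteGaloisGroup.toAlgEquiv K).toMonoidHom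

variable {p : ℕ} [Fact p.Prime]

/-- **Norm of a Heegner point of conductor `c` to the layer `K_n`.** `z ∈ E(K̄)` is
`Norm_{K[c]/K_n} P[c] = ∑_{σ ∈ Gal(K[c]/K_n)} σ P[c]` for a Heegner point `P[c] = x` of conductor `c`
(`IsHeegnerGeomPoint`, fixed by `Gal(K̄/K[c])`), the sum being taken over a transversal `R` of
`Gal(K̄/K[c])` in `Gal(K̄/K_n) = κ.layerSubgroup n`, precisely: `R ⊆ Gal(K̄/K_n)` meets every
coset `τ · Gal(K̄/K[c])`, `τ ∈ Gal(K̄/K_n)`, exactly once — a transversal of `Gal(K̄/K_n K[c])` in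
`Gal(K̄/K_n)`, so the sum is `Norm_{K_n K[c]/K_n}`, which is `Norm_{K[c]/K_n}` when `K_n ⊆ K[c]`
(Howard 2004, §3.3: under `p ∤ h_K`, "`K_k` is the maximal `p`-power subextension of `K[p^{k+1}]/K`",
`P_k[1] = Norm_{K[p^{k+1}]/K_k[1]} P[p^{k+1}]` and `Norm_{K_k[1]/K_k} P_k[1] ∈ E(K_k)`; Perrin-Riou
1987, §3.2–3.4: `D_n = H_{cp^n} ∩ D_∞`, `tr_{H_{cp^n}/D_n} e_{cp^n}`). The cases used below are
`(n, c) = (0, 1)` (`y_K = Norm_{K[1]/K} P[1] ∈ E(K)`, the point of `IsHeegnerPoint`) and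
`(n, c) = (j, p^{j+1})`; `z` is then fixed by `Gal(K̄/K_n)` (`IsHeegnerNormPoint.smul_eq_self`).
[cite: Howard2004HeegnerKolyvagin, §3.3] [cite: PerrinRiou1987BSMF, §3.4] -/
def IsHeegnerNormPoint (κ : ZpExtension K p) (Dt : ModularParametrizationData W N) (β : ℤ)
    (jbar : AlgebraicClosure K →+* ℂ) (n c : ℕ) (z : geomPoints (W.baseChange K)) : Prop :=
  ∃ (x : geomPoints (W.baseChange K)) (R : Finset (Field.absoluteGaloisGroup K)),
    IsHeegnerGeomPoint N W K Dt β c jbar x ∧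
    (∀ σ ∈ ringClassSubgroup K c jbar, σ • x = x) ∧
    (↑R ⊆ (κ.layerSubgroup n : Set (Field.absoluteGaloisGroup K))) ∧
    (∀ τ ∈ κ.layerSubgroup n, ∃! r, r ∈ R ∧ r⁻¹ * τ ∈ ringClassSubgroup K c jbar) ∧
    z = ∑ r ∈ R, r • x

variable {N W K}

/-- **A norm to `K_n` is `K_n`-rational**: if `z = ∑_{r ∈ R} r • x` over a transversal `R` of
`Gal(K̄/K[c])` in `Gal(K̄/K_n)` with `x` fixed by `Gal(K̄/K[c])`, then `τ • z = z` for every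
`τ ∈ Gal(K̄/K_n)` (`τ` permutes the cosets: pure group theory, no CM input). Howard 2004, §3.3
(`Norm_{K_k[1]/K_k} P_k[1] ∈ E(K_k)`). [folklore] -/
theorem IsHeegnerNormPoint.smul_eq_self {κ : ZpExtension K p} {Dt : ModularParametrizationData W N}
    {β : ℤ} {jbar : AlgebraicClosure K →+* ℂ} {n c : ℕ} {z : geomPoints (W.baseChange K)}
    (h : IsHeegnerNormPoint N W K κ Dt β jbar n c z) {τ : Field.absoluteGaloisGroup K}
    (hτ : τ ∈ κ.layerSubgroup n) : τ • z = z := by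
  obtain ⟨x, R, -, hfix, hRsub, htrans, rfl⟩ := h
  set G := ringClassSubgroup K c jbar with hG
  -- the coset permutation `r ↦ r'`, `r'⁻¹ (τ r) ∈ G`
  have key : ∀ r ∈ R, ∃! r', r' ∈ R ∧ r'⁻¹ * (τ * r) ∈ G := fun r hr ↦
    htrans (τ * r) ((κ.layerSubgroup n).mul_mem hτ (hRsub hr))
  choose! f hf using fun r (hr : r ∈ R) ↦ (key r hr).exists
  have hval : ∀ r ∈ R, (τ * r) • x = f r • x := fun r hr ↦ by
    have h1 : (f r)⁻¹ * (τ * r) ∈ G := (hf r hr).2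
    calc (τ * r) • x = (f r * ((f r)⁻¹ * (τ * r))) • x := by rw [mul_inv_cancel_left]
      _ = f r • ((f r)⁻¹ * (τ * r)) • x := mul_smul _ _ _
      _ = f r • x := by rw [hfix _ h1]
  have hinj : Set.InjOn f ↑R := by
    intro r₁ hr₁ r₂ hr₂ heq
    have h1 : (f r₁)⁻¹ * (τ * r₁) ∈ G := (hf r₁ hr₁).2
    have h2 : (f r₂)⁻¹ * (τ * r₂) ∈ G := (hf r₂ hr₂).2
    rw [heq] at h1
    have h12 : r₁⁻¹ * r₂ ∈ G := by
      have := G.mul_mem (G.inv_mem h1) h2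
      rwa [show ((f r₂)⁻¹ * (τ * r₁))⁻¹ * ((f r₂)⁻¹ * (τ * r₂)) = r₁⁻¹ * r₂ by group] at this
    -- uniqueness of the representative of the coset of `r₂ ∈ Gal(K̄/K_n)`
    have hu := htrans r₂ (hRsub hr₂)
    exact hu.unique ⟨hr₁, h12⟩ ⟨hr₂, by rw [inv_mul_cancel]; exact G.one_mem⟩
  have hmaps : Set.MapsTo f ↑R ↑R := fun r hr ↦ (hf r hr).1
  have hsurj : Set.SurjOn f ↑R ↑R :=
    Finset.surjOn_of_injOn_of_card_le f hmaps hinj le_rfl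
  rw [Finset.smul_sum]
  simp_rw [← mul_smul]
  exact Finset.sum_nbij f hmaps hinj hsurj hval

/-- **A Heegner family along the anticyclotomic tower** (data + hypotheses): a parametrisation datum
`Dt` and an orientation `β` (`β² ≡ d_K (mod 4N)`, i.e. the ideal `𝔫`), fixed for the whole family,
the basic Heegner point `y = y_K = Norm_{K[1]/K} P[1]` and the norm points
`z j = Norm_{K[p^{j+1}]/K_j} P[p^{j+1}] ∈ E(K_j)` (`IsHeegnerNormPoint`). These generate Howard's
modules `H_k ⊆ E(K_k) ⊗ ℤ_p` (§3.3, before Thm. 3.3.7: "generated by `Norm_{K[1]/K} P[1]` and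
`Norm_{K_k[1]/K_k} P_j[1]` for `0 ≤ j ≤ k`") = Perrin-Riou's `ℋ_k` (§3.4). Such families EXIST under
the Heegner hypothesis with `p ∤ N` — the CM input "`P[m] ∈ E(K[m])`" is the named fact
`exists_isHeegnerNormPoint` below, assembled into `Nonempty (HeegnerFamily …)` by the theorem
`nonempty_heegnerFamily_of`.
[cite: Howard2004HeegnerKolyvagin, §3.3 (before Thm. 3.3.7)] [cite: PerrinRiou1987BSMF, §3.4] -/
structure HeegnerFamily (N : ℕ) [NeZero N] (W : WeierstrassCurve ℚ) (K : Type u) [Field K]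
    [NumberField K] {p : ℕ} [Fact p.Prime] (κ : ZpExtension K p)
    (jbar : AlgebraicClosure K →+* ℂ) where
  /-- The modular parametrisation datum (fixes `φ : X₀(N) → E`). -/
  Dt : ModularParametrizationData W N
  /-- The orientation: a residue `β` with `β² ≡ d_K (mod 4N)` (the ideal `𝔫`). -/
  β : ℤ
  /-- `β² ≡ d_K (mod 4N)`. -/
  dvd_sq_sub : (4 * N : ℤ) ∣ β ^ 2 - NumberField.discr K
  /-- The basic Heegner point `y_K ∈ E(K)`. -/
  y : geomPoints (W.baseChange K)
  /-- `y = Norm_{K[1]/K} P[1]`. -/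
  isHeegnerNormPoint_y : IsHeegnerNormPoint N W K κ Dt β jbar 0 1 y
  /-- The norm points `z_j ∈ E(K_j)` of conductor `p^{j+1}`. -/
  z : ℕ → geomPoints (W.baseChange K)
  /-- `z j = Norm_{K[p^{j+1}]/K_j} P[p^{j+1}]`. -/
  isHeegnerNormPoint_z : ∀ j, IsHeegnerNormPoint N W K κ Dt β jbar j (p ^ (j + 1)) (z j)

namespace HeegnerFamily

variable {κ : ZpExtension K p} {jbar : AlgebraicClosure K →+* ℂ} (F : HeegnerFamily N W K κ jbar)

/-- The generators of the family visible at layer `k`: `y_K` and `z_j` for `j ≤ k`.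
[cite: Howard2004HeegnerKolyvagin, §3.3 (before Thm. 3.3.7)] -/
def generators (k : ℕ) : Set (geomPoints (W.baseChange K)) :=
  {F.y} ∪ F.z '' {j | j ≤ k}

/-- Every generator visible at layer `k` is fixed by `Gal(K̄/K_k)` (it is `K_j`-rational for some
`j ≤ k`, and `K_j ⊆ K_k`). [folklore] -/
theorem smul_eq_of_mem_generators {k : ℕ} {w : geomPoints (W.baseChange K)} (hw : w ∈ F.generators k)
    {σ : Field.absoluteGaloisGroup K} (hσ : σ ∈ κ.layerSubgroup k) : σ • w = w := by
  rcases hw with hw | ⟨j, hj, rfl⟩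
  · rw [Set.mem_singleton_iff.mp hw]
    exact F.isHeegnerNormPoint_y.smul_eq_self (κ.layerSubgroup_antitone (Nat.zero_le k) hσ)
  · exact (F.isHeegnerNormPoint_z j).smul_eq_self (κ.layerSubgroup_antitone hj hσ)

/-- **`y_K` is `K`-rational**: the basic Heegner point of a family is fixed by `Γ_K`
(`IsHeegnerNormPoint.smul_eq_self` at the layer `K_0 = K`, `κ.layerSubgroup 0 = ⊤`), hence comes
from `E(K)` by Galois descent (`exists_toGeomPoints_eq_of_forall_smul_eq`). Gross 1991, §1
(`y_K = Tr_{K_1/K} y_1 ∈ E(K)`); Howard 2004, §2.7 (`Norm_{K[1]/K} P[1]`). [folklore] -/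
theorem exists_toGeomPoints_eq_y :
    ∃ P : (W.baseChange K).toAffine.Point, toGeomPoints (W.baseChange K) P = F.y :=
  exists_toGeomPoints_eq_of_forall_smul_eq _ fun σ ↦
    F.isHeegnerNormPoint_y.smul_eq_self (by rw [ZpExtension.layerSubgroup_zero]; trivial)

end HeegnerFamily

variable (N W K) (p) in
/-- **Heegner points of every conductor `c` prime to `N` exist, are rational over the ring class
field `K[c]`, and have norms to the layers** (the CM input of the whole theory). Printed: Howard
2004, §2.7: "For every integer of the form `m = p^k n` … let `h_m ∈ X₀(N)` be the point corresponding
to the cyclic `N`-isogeny of complex tori `h_m = [ℂ/𝒪_m → ℂ/(𝒪_m ∩ 𝔞)⁻¹]` … The point `h_m` is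
rational over the ring class field of conductor `m`, which we denote by `K[m]` … The image of `h_m`
is now denoted by `P[m] ∈ E(K[m])`, the Heegner point of conductor `m`" (standing: `E/ℚ` elliptic of
conductor `N`, `K` imaginary quadratic, `p ∤ N`, all primes dividing `N` split in `K`, `𝔞` an ideal
with `𝒪_K/𝔞 ≅ ℤ/N`, i.e. an orientation `β`); §3.3: "`P_k[n] = Norm_{K[np^{k+1}]/K_k[n]} P[np^{k+1}]`",
`Norm_{K_k[1]/K_k} P_j[1]`; Gross 1991, §3 (`x_n ∈ X₀(N)(K_n)`, `y_n ∈ E(K_n)` for `n` prime to `N`);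
Perrin-Riou 1987, §3.1 (`y_c[𝔞] ∈ X₀(N)(H_c)`, `Gal(H_c/k) ≅ Pic(𝒪_c)` finite); the underlying CM
theorems are Darmon 2004, Thm. 3.6 ("let `H/K` be the ring class field attached to `𝒪`. Then `Φ_N(τ)`
belongs to `E(H)`") with `K(j(𝒪_c)) = K[c]` (Cox, Thm. 11.1). In the tree's terms: for an elliptic
`W/ℚ` with a parametrisation datum at level `N`, `K` imaginary quadratic satisfying the Heegner
hypothesis for `N`, an orientation `β`, `gcd(c, N) = 1`, any `jbar : K̄ → ℂ`, any `ℤ_p`-extension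
`κ` and layer `n`, there is a geometric point which is the norm to `K_n` of a `K[c]`-rational
Heegner point of conductor `c` (`IsHeegnerNormPoint`: the point `x` with `complexPoint x = φ(τ_Q)`
fixed by `Gal(K̄/K[c])`, of finite index in `Γ_K`, summed over a transversal). The conductor-`1`
trace to `K` is the tree's `exists_isHeegnerPoint` / `heegnerPointComplex_mem_range_map`.
[cite: Howard2004HeegnerKolyvagin, §2.7 and §3.3] [cite: GrossLMS1991, §3] [cite: Darmon2004, Thm. 3.6]
[cite: PerrinRiou1987BSMF, §3.1] -/
def exists_isHeegnerNormPoint : Prop :=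
  ∀ [W.IsElliptic] (_ : IsImaginaryQuadratic K) (_ : SatisfiesHeegnerHypothesis N K)
    (κ : ZpExtension K p) (Dt : ModularParametrizationData W N) {β : ℤ}
    (_ : (4 * N : ℤ) ∣ β ^ 2 - NumberField.discr K) (jbar : AlgebraicClosure K →+* ℂ) (n : ℕ) {c : ℕ}
    (_ : c.Coprime N), ∃ z, IsHeegnerNormPoint N W K κ Dt β jbar n c z

/-- **Heegner families exist** (assembly of `exists_isHeegnerNormPoint`): under the Heegner hypothesis
with `p ∤ N`, for every parametrisation datum `Dt`, orientation `β`, embedding `jbar` and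
`ℤ_p`-extension `κ` there is a `HeegnerFamily` — `y` of conductor `1` over `K_0 = K` and `z j` of
conductor `p^{j+1}` (prime to `N`) over `K_j`. This is the non-vacuity of the hypotheses of the named
facts below. [cite: Howard2004HeegnerKolyvagin, §2.7 and §3.3] -/
theorem nonempty_heegnerFamily_of (h : exists_isHeegnerNormPoint N W K p) [W.IsElliptic]
    (hK : IsImaginaryQuadratic K) (hH : SatisfiesHeegnerHypothesis N K) (hp : ¬ p ∣ N)
    (κ : ZpExtension K p) (Dt : ModularParametrizationData W N) {β : ℤ}
    (hβ : (4 * N : ℤ) ∣ β ^ 2 - NumberField.discr K) (jbar : AlgebraicClosure K →+* ℂ) :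
    Nonempty (HeegnerFamily N W K κ jbar) := by
  have hc : ∀ j : ℕ, (p ^ (j + 1)).Coprime N := fun j ↦
    Nat.Coprime.pow_left _ (((Fact.out : p.Prime)).coprime_iff_not_dvd.mpr hp)
  choose z hz using fun j : ℕ ↦ h hK hH κ Dt hβ jbar j (hc j)
  obtain ⟨y, hy⟩ := h hK hH κ Dt hβ jbar 0 (Nat.coprime_one_left N)
  exact ⟨⟨Dt, β, hβ, y, hy, z, hz⟩⟩

end HeegnerGeom

/-! ## Part 4. The Heegner module `ℋ_∞ ⊆ 𝔖_p(K_∞)`, its characteristic ideal and its index -/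

section HeegnerModule

variable {K : Type u} [Field K] [NumberField K] {N : ℕ} [NeZero N] {W : WeierstrassCurve ℚ}
  {p : ℕ} [Fact p.Prime] {κ : ZpExtension K p} {γ : Field.absoluteGaloisGroup K}
  {jbar : AlgebraicClosure K →+* ℂ}

/-- **The finite-level Heegner module `ℋ̄_k ⊆ S_p(E/K_k)`** (inside `∏_m H¹(Gal(K̄/K_k), E[p^m])`):
the additive subgroup generated by the elements `c · conj_{γ^i} δ(w)` for `c ∈ ℤ_p`, `i ∈ ℕ` and
`w` a generator visible at layer `k`, where `δ(w) = (δ_{K_k}(w) ∈ H¹(K_k, E[p^m]))_m` is the family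
of Kummer classes of `w` (`kummerClassOver` at every `p^m`-th root `Q` of `w`; it depends only on
`w`, and roots exist in characteristic `0`, `zsmul_geomPoints_surjective_of_charZero`) — i.e. the
image under the injective Kummer map `E(K_k) ⊗ ℤ_p ↪ S_p(E/K_k)` of Howard's
`H_k = ℤ_p[Gal(K_k/K)] · {y_K, z_0, …, z_k}` (§3.3) = Perrin-Riou's `ℋ_k` (§3.4, trivial character).
A closure, so that no module axioms on the ambient product are needed.
[cite: Howard2004HeegnerKolyvagin, §3.3 (H_k, before Thm. 3.3.7)] [cite: PerrinRiou1987BSMF, §3.4] -/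
def heegnerModuleLayer (γ : Field.absoluteGaloisGroup K) (F : HeegnerFamily N W K κ jbar) (k : ℕ) :
    AddSubgroup (Π m : ℕ, (W.baseChange K).torsionH1Over ((p : ℤ) ^ m) (κ.layerSubgroup k)) :=
  AddSubgroup.closure {v | ∃ (c : ℤ_[p]) (i : ℕ) (w : geomPoints (W.baseChange K))
    (hw : w ∈ F.generators k)
    (d : Π m : ℕ, (W.baseChange K).torsionH1Over ((p : ℤ) ^ m) (κ.layerSubgroup k)),
    (∀ (m : ℕ) (Q : geomPoints (W.baseChange K)) (hQ : ((p : ℤ) ^ m) • Q = w),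
      d m = (W.baseChange K).kummerClassOver (κ.layerSubgroup k) ((p : ℤ) ^ m) Q
        (fun σ hσ ↦ by rw [hQ]; exact F.smul_eq_of_mem_generators hw hσ)) ∧
    v = (W.baseChange K).padicPi p (κ.layerSubgroup k) c
      ((W.baseChange K).conjPi p (κ.layerSubgroup k) (γ ^ i) d)}

variable (D : (W.baseChange K).LambdaAdicSelmerData κ γ) (F : HeegnerFamily N W K κ jbar)

/-- **The Heegner module `ℋ_∞ = lim←_k ℋ_k ⊆ 𝔖_p(K_∞)`** (Perrin-Riou 1987, §3.4: "Soit `ℋ_∞` la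
limite projective des `ℋ_n` relativement aux morphismes de trace. C'est un sous-`Λ`-module de
`𝔖_p(H_c)`"; §1 p. 405: "Ce `Λ`-module `H_∞` est un sous-module de `𝔖_p(D_∞)`"; Howard 2004, §3.3:
`𝐇 = lim← H_k`, mapped into `H¹(K, 𝐓) = lim← H¹(K_k, T_p E)` by the injective Kummer map): the
`Λ`-span of the elements of `S` all of whose level-`k` projections lie in `ℋ̄_k`
(`heegnerModuleLayer`). [cite: PerrinRiou1987BSMF, §3.4 and §1 p. 405]
[cite: Howard2004HeegnerKolyvagin, §3.3 (𝐇 = lim H_k)] -/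
def heegnerModule : Submodule (IwasawaAlgebra p) D.S :=
  Submodule.span (IwasawaAlgebra p) {s | ∀ k, D.proj k s ∈ heegnerModuleLayer γ F k}

/-- **Perrin-Riou's `I(ℋ_∞)`**: the characteristic ideal of the `Λ`-module `𝔖_p(K_∞)/ℋ_∞`
(Bull. SMF 115, §1, p. 405: "la série caractéristique `I(H_∞)` du quotient de `𝔖_p(D_∞)` par `H_∞`,
en tant que `Λ`-module; il est non nul si et seulement si `H_∞` et `𝔖_p(D_∞)` sont de même rang égal
à `1`"; Howard 2004, §1: `𝐋 = char(H¹_{F_Λ}(K, 𝐓)/𝐇)`), through the tree's `Module.charIdeal`.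
[cite: PerrinRiou1987BSMF, §1 p. 405] [cite: Howard2004HeegnerKolyvagin, §1 eq. (2)] -/
def heegnerCharIdeal : Ideal (IwasawaAlgebra p) :=
  Module.charIdeal (IwasawaAlgebra p) (D.S ⧸ heegnerModule D F)

/-- **The Heegner module index `a(E, K, p) = ord_J I(ℋ_∞) ∈ ℕ∞`**: the multiplicity of the
augmentation prime `J = (γ - 1) = (T)` in the characteristic ideal of `𝔖_p(K_∞)/ℋ_∞`, i.e. the
length of the localisation `(S/ℋ_∞)_{(T)}` over the discrete valuation ring `Λ_{(T)}`
(`Module.lengthAt`; the exponent of `(T)` in `Module.charIdeal` by definition of the latter).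
Howard 2004, §1, eq. (2): "`rank_{ℤ_p} S_p(E/K) ≤ 1 + 2 · ord_J(𝐋)` where `J ⊂ Λ` is the augmentation
ideal and `𝐋 = ch(H¹_{F_Λ}(K, 𝐓)/𝐇)`". Value `⊤` iff `S/ℋ_∞` is not torsion at `(T)` (e.g. `ℋ_∞ = 0`).
When `S ≅ Λ` is torsion-free of rank one and `ℋ_∞ = Λ κ_∞` (the theorems below), it equals
`max {a : κ_∞ ∈ (γ - 1)^a S ⊗ ℚ_p}`, the divisibility index of the `Λ`-adic Heegner class.
[cite: Howard2004HeegnerKolyvagin, §1 eq. (2)] [cite: PerrinRiou1987BSMF, §1 p. 405] -/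
def heegnerModuleIndex : ℕ∞ :=
  Module.lengthAt (IwasawaAlgebra p) (D.S ⧸ heegnerModule D F)
    ⟨Ideal.span {(PowerSeries.X : IwasawaAlgebra p)}, PowerSeries.span_X_isPrime⟩

/-- Unfolding of `heegnerModuleIndex`. [folklore] -/
theorem heegnerModuleIndex_def : heegnerModuleIndex D F =
    Module.lengthAt (IwasawaAlgebra p) (D.S ⧸ heegnerModule D F)
      ⟨Ideal.span {(PowerSeries.X : IwasawaAlgebra p)}, PowerSeries.span_X_isPrime⟩ :=
  rfl

end HeegnerModule

/-! ## Part 5. The theorems (Howard 2004; Perrin-Riou 1987; Cornut 2002) as named facts -/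

section Facts

variable (N : ℕ) [NeZero N] (W : WeierstrassCurve ℚ) [W.IsGloballyMinimal] (K : Type u) [Field K]
  [NumberField K] (p : ℕ) [Fact p.Prime] (κ : ZpExtension K p) (γ : Field.absoluteGaloisGroup K)
  (jbar : AlgebraicClosure K →+* ℂ)

/-- **Howard's standing hypotheses** (Compositio 140 (2004), Thm. A and Thm. B with §3): `E/ℚ`
elliptic; `K` imaginary quadratic of discriminant `D ≠ -3, -4` satisfying the Heegner hypothesis
for `N` ("all primes dividing `N` are split in `K`"); "`p` is odd and the integers `p`, `D`, and `N`
are pairwise coprime" (`gcd(D, N) = 1` follows from the Heegner hypothesis); "`Gal(K̄/K) → Aut_{ℤ_p}(T)`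
is surjective" for `T = T_p(E)` (every `ℤ_p`-automorphism of the tree's `tateModule` is a Galois
element, `galoisRepTate`); "`E` is ordinary at `p`" (good ordinary, `p ∤ N`: tree `IsOrdinaryAt`);
"`p` does not divide the class number of `K`" (Thm. B); `κ` is the anticyclotomic `ℤ_p`-extension
and `γ` a topological generator (§3). The level `N` is tied to `E` by the parametrisation datum of a
`HeegnerFamily`. [cite: Howard2004HeegnerKolyvagin, §1 Thm. A, Thm. B and §3] -/
structure HowardHypotheses : Prop where
  /-- `E` is an elliptic curve. -/
  isElliptic : W.IsElliptic
  /-- `K` is imaginary quadratic. -/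
  isImaginaryQuadratic : IsImaginaryQuadratic K
  /-- `d_K ≠ -3, -4`. -/
  discr_ne : NumberField.discr K ≠ -3 ∧ NumberField.discr K ≠ -4
  /-- Every prime dividing `N` splits in `K`. -/
  heegner : SatisfiesHeegnerHypothesis N K
  /-- `p` is odd. -/
  p_ne_two : p ≠ 2
  /-- `p ∤ N`. -/
  not_dvd_level : ¬ p ∣ N
  /-- `p ∤ d_K`. -/
  not_dvd_discr : ¬ (p : ℤ) ∣ NumberField.discr K
  /-- `p ∤ h_K`. -/
  not_dvd_classNumber : ¬ p ∣ NumberField.classNumber K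
  /-- `Γ_K → Aut_{ℤ_p}(T_p E)` is surjective. -/
  surjective : ∀ f : Module.End ℤ_[p] ((W.baseChange K).tateModule p), IsUnit f →
    f ∈ Set.range (galoisRepTate (W.baseChange K) p)
  /-- `E` has good ordinary reduction at `p`. -/
  ordinary : IsOrdinaryAt W p
  /-- `κ` is the anticyclotomic `ℤ_p`-extension of `K`. -/
  anticyclotomic : κ.IsAnticyclotomic
  /-- `γ` is a topological generator of `Gal(K_∞/K)`. -/
  topGenerator : κ.IsTopGenerator γ

/-- **Howard 2004, Theorem B** (Compositio 140, §1; = Thm. 3.2.10 with the Kolyvagin system of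
Thm. 3.3.1), printed: "The `Λ`-module `H¹_{F_Λ}(K, 𝐓)` is torsion-free of rank one, and there is a
finitely-generated torsion `Λ`-module `M` such that (a) `ch(M) = ch(M)^ι`, (b) `X ∼ Λ ⊕ M ⊕ M`,
(c) `ch(M)` divides `ch(H¹_{F_Λ}(K, 𝐓)/𝐇)`", where `X = Hom(H¹_{F_Λ}(K, 𝐀), ℚ_p/ℤ_p)`,
`H¹_{F_Λ}(K, 𝐓) ∼ lim← S_p(E/K_n)` and `H¹_{F_Λ}(K, 𝐀) ∼ lim→ Sel_{p^∞}(E/K_n)` (§1), `𝐇 = Λ κ₁^{Heeg}`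
the Heegner module (Thm. 3.3.7). Recorded, under `HowardHypotheses`, for every `Λ`-adic Selmer datum
`D`, Heegner family `F` (which ties `N = N_E`) and Iwasawa-module datum `X` of
`Sel_{p^∞}(E/K_∞) = lim→ Sel_{p^∞}(E/K_n)` (`SelmerDualData` for the anticyclotomic `κ`), through
consequences invariant under the printed pseudo-isomorphisms:
* `D.S` is finitely generated, torsion-free, of rank one — the rank is a pseudo-isomorphism
  invariant and `lim← S_p(E/K_n)` is itself finitely generated and torsion-free by Perrin-Riou 1987,
  §2.2 Lemme 5 (i): "Le `Λ`-module `𝔖_p(D_∞)` est isomorphe à `Hom_Λ(R(D_∞), Λ)`" (`R(D_∞)` the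
  torsion-free quotient of the finitely generated dual Selmer module; used in §3.4: "`ℋ_∞` …
  sous-`Λ`-module de `𝔖(H_c)` … il est sans torsion par le lemme 5"; reflexivity, hence freeness, is
  not recorded);
* `X` is finitely generated of rank one and `char(X_{Λ-tors}) = ch(M)²` divides `I(ℋ_∞)²`
  (`heegnerCharIdeal`; `X_{Λ-tors} ∼ M ⊕ M` from (b)).
The functional equation (a) `ch(M) = ch(M)^ι` is not recorded (weaker, never stronger). Parts of this
are also Bertolini 1995 + Cornut 2002 + Nekovář, as Howard notes.
[cite: Howard2004HeegnerKolyvagin, §1 Thm. B and Thm. 3.2.10 (journal: Thm. 2.2.10)] [cite: PerrinRiou1987BSMF, §2.2 Lemme 5 (i)] -/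
def Howard2004_thmB : Prop :=
  ∀ (_ : HowardHypotheses N W K p κ γ) (D : (W.baseChange K).LambdaAdicSelmerData κ γ)
    (F : HeegnerFamily N W K κ jbar) (X : (W.baseChange K).SelmerDualData κ γ),
    (Module.Finite (IwasawaAlgebra p) D.S ∧ NoZeroSMulDivisors (IwasawaAlgebra p) D.S ∧
      Module.finrank (IwasawaAlgebra p) D.S = 1) ∧
    (Module.Finite (IwasawaAlgebra p) X.X ∧ Module.finrank (IwasawaAlgebra p) X.X = 1 ∧
      Module.charIdeal (IwasawaAlgebra p) (Submodule.torsion (IwasawaAlgebra p) X.X) ∣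
        heegnerCharIdeal D F ^ 2)

/-- **Howard 2004, Thm. 3.3.7 (with Perrin-Riou 1987, §3.4 Prop. 10 and Cornut 2002): the Heegner
module `ℋ_∞` is free of rank one over `Λ`.** Printed: "The `Λ`-module `𝐇` is free of rank one,
generated by `κ̃₁`. Proof. By the main result of [Cornut], one of the points `Norm_{K_k[1]/K_k} P_k[1]`
has infinite order, and so Proposition 10 of section 3 of [Perrin-Riou] implies that `𝐇` is free of
rank one"; Perrin-Riou, Prop. 10: "S'il existe un entier `n` tel que `e_{cp^n}` est d'ordre infini, le
`Λ`-module `ℋ_∞` est libre de rang `1`; il est nul sinon." Here for `heegnerModule D F`, the image of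
`𝐇` in `S` under the injective Kummer map. [cite: Howard2004HeegnerKolyvagin, Thm. 3.3.7 (journal: Thm. 2.3.7)]
[cite: PerrinRiou1987BSMF, §3.4 Prop. 10] [cite: Cornut2002] -/
def Howard2004_heegnerModule_free : Prop :=
  ∀ (_ : HowardHypotheses N W K p κ γ) (D : (W.baseChange K).LambdaAdicSelmerData κ γ)
    (F : HeegnerFamily N W K κ jbar),
    Module.Free (IwasawaAlgebra p) (heegnerModule D F) ∧
      Module.finrank (IwasawaAlgebra p) (heegnerModule D F) = 1

/-- **Howard 2004, §1, eq. (2): the Kolyvagin bound at the trivial character.** Printed: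
"part (c) of the theorem, together with the control theorem, gives the inequality
`rank_{ℤ_p} S_p(E/K) ≤ 1 + 2 · ord_J(𝐋)` where `J ⊂ Λ` is the augmentation ideal and
`𝐋 = ch(H¹_{F_Λ}(K, 𝐓)/𝐇)`", and (same §) "by Mazur's control theorem one has
`rank_{ℤ_p} X/(γ - 1)X = corank_{ℤ_p} Sel_{p^∞}(E/K)`"; `rank_{ℤ_p} S_p(E/K) = corank_{ℤ_p} Sel_{p^∞}(E/K)`
(both equal `rank E(K) + corank Ш(E/K)[p^∞]`), recorded with the tree's `selmerCorank` of `E/K` and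
`ord_J(𝐋) = heegnerModuleIndex D F ∈ ℕ∞` (trivially true when the index is `⊤`).
[cite: Howard2004HeegnerKolyvagin, §1 eq. (2)] -/
def Howard2004_selmerCorank_le : Prop :=
  ∀ (_ : HowardHypotheses N W K p κ γ) (D : (W.baseChange K).LambdaAdicSelmerData κ γ)
    (F : HeegnerFamily N W K κ jbar),
    (((W.baseChange K).selmerCorank p : ℕ) : ℕ∞) ≤ 1 + 2 * heegnerModuleIndex D F

variable {N W K p κ γ jbar}

/-- **Corollary: `rank E(K) ≤ 1 + 2 · a(E, K, p)`** from Howard's bound and the corank identity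
`corank Sel_{p^∞}(E/K) = rank E(K) + corank Ш(E/K)[p^∞]` (tree fact
`selmerCorank_eq_mordellWeilRank_add`, Greenberg 1999 §1). This is the form in which the request uses
the index ("`a = 1` ⇒ `corank ≤ 3`"). [cite: Howard2004HeegnerKolyvagin, §1 eq. (2) and Thm. A] -/
theorem Howard2004_selmerCorank_le.mordellWeilRank_le (h : Howard2004_selmerCorank_le N W K p κ γ jbar)
    (hsel : (W.baseChange K).selmerCorank_eq_mordellWeilRank_add)
    (hyp : HowardHypotheses N W K p κ γ) (D : (W.baseChange K).LambdaAdicSelmerData κ γ)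
    (F : HeegnerFamily N W K κ jbar) :
    (((W.baseChange K).mordellWeilRank : ℕ) : ℕ∞) ≤ 1 + 2 * heegnerModuleIndex D F := by
  haveI := hyp.isElliptic
  refine le_trans ?_ (h hyp D F)
  have hle : (W.baseChange K).mordellWeilRank ≤ (W.baseChange K).selmerCorank p := by
    rw [hsel p]; exact Nat.le_add_right _ _
  exact_mod_cast hle

end Facts

end Literature.NumberTheory.EllipticCurves
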